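import Summits.QuantumFields.BalabanUV.T4Continuum.Support.CTAveragedTowerDecay
import Summits.QuantumFields.BalabanUV.T4Continuum.Support.CTConjugationTorus
import Summits.QuantumFields.BalabanUV.T4Continuum.Support.DirichletRegionTower
import Summits.QuantumFields.BalabanUV.T4Continuum.Spine.NE2BalabanDecayRate
import Literature.MathematicalPhysics.QuantumFieldTheory.Balaban1983to89.Beta.VectorTailsCov

/-!
# T⁴ programme, spine node NE2 (U1a), sub-row Δ3 «NE2-WALK» (T4-DAG `T4-U1a.S-NE2-D3-WALK°`) — THE CANONICAL COMBES–THOMAS WEIGHTS ON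
# KING's TOWER and `hdec` FROM CONJUGATED BOUNDS: the fine-scale block distance to a unit site is `1/n_k`-Lipschitz along fine bonds,
# `≤ 0` on the centre block and `≥ dist − 2` on every other block; so a level-uniform conjugated-inverse bound for `Δ_a^{(k)}⊗1 + t·P_k`
# IS the displayed decay binder `hdec` of `Spine/NE2BalabanDecayRate`

NE2 formalisation swarm `b2b-balaban-t4-ne2-formalise-*`, leaf prover 06 (gen 3), supplier item «Δ3-CT» under the row owner's sub-row Δ3
(INTENT CLAIMS.log l.14496), file B (file A = `Support/CTAveragedTowerDecay`, the generic dictionary).  The β-cell's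
`Literature/…/Beta/DeltaACombesThomas` (U = 1, vector `Δ_a`) lists as NOT contained «(ii) a concrete admissible `ρ` built from the block
distance of `T₁^{(k)}` (geometry; the hypotheses `hℓ`, `hL` are what it must satisfy)».  THIS FILE builds that weight on the lineage's tower
index `idx L M k = Tor (fine n_k M) × Fin d` (`n_k = lev L k = L^k`) and wires it to the NE2 objects:
 * §1 READINGS: `toM x` (a unit site `x ∈ Tor (fine n_0 M)` read in `Tor M`), `val_prtk` (`BlockSumDecay.prtk (prtQ L M) k u` has coordinates
   `⌊u_ν/n_k⌋`), **`blockOf_eq_toM_prtk`** (pv15's `B5Blocks16.blockOf` IS that parent read in `Tor M`), `prtk_prtQK`, the unit-lattice distance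
   **`distK x y = tdist (toM x) (toM y)`** (`Beta/VectorTailsCov.tdist`: sup-distance through the centred lift; symmetric, triangle inequality,
   volume-uniform summability in that module) and its colour version `distKC`.
 * §2 THE SITE WEIGHT **`rhoSite k y x = tdist (ctr k y) x / n_k − 1`** (`ctr k y = bpt n_k M (toM y) 0`, the corner of the block of `y`) and its
   bond reading `rho k y = bondW₀ (rhoSite k y)` (`CTConjugationTorus.bondW₀`): (G1) **`abs_rhoSite_fineStep_le`** / **`abs_rho_fineStep_le`**
   `|ρ(x + e_ν) − ρ(x)| ≤ 1/n_k` — the `hℓ` binder shape of `DeltaACombesThomas.calG_form_decay_of_pieces`; `abs_rhoSite_sub_le_one_of_blockOf_eq`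
   (block oscillation `≤ 1`); **`abs_rho_stencil_le`** (stencil oscillation `≤ 2` — the `hL` binder shape with `L := 2`); (G2) **`rho_nonpos_of_prtk`**
   (`ρ_y ≤ 0` on the unit block of `y`) and **`distK_sub_two_le_rho`** (`ρ_y ≥ distK x y − 2` on the unit block of `x`;
   `VectorTailsCov.supNorm_liftZ_sub_le` BY NAME).  The substrate cell's `ScalarCovariantCoercive.rhoS` is the same construction for a fine
   source SET on `TorusG0Decay.ldist` (PRIOR, parallel); this one is centred at a UNIT SITE and compared with the unit-lattice block distance.
 * §3 ENDs on the colour tower `pertCovC P t k` (`Spine/NE2ColourPerturbedLayer`), weights read through sites (`fun p => rho k y.1 p.1`):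
   **`hdec_pertCovC_of_conjInv`** — `∀ k y, ‖conjMat κ ρ_{k,y} ρ_{k,y} ((Δ_a^{(k)}⊗1 + t•P_k)⁻¹)‖ ≤ K` (`κ ≥ 0`) ⟹
   `∀ k, EntryDecay distKC (pertCovC P t k) (K·e^{2κ}) κ` = THE BINDER `hdec` of `NE2BalabanDecayRate.decayStations_pertCovC(_rate)` /
   `balaban_final_decayStations_of_regular`; **`hdec_pertCovC_of_wCoercive`** — from the two DISPLAYED inputs of file A, the `U = 1` weighted
   coercivity `hW : ∀ k y, WCoercive (Δ_a^{(k)}) κ (rho k y) γw` (UN-LIFTED; the shape the substrate programme VEC is to deliver for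
   `B5DeltaA169.DeltaA` = `calDalev` by `calDa_eq_DeltaA`) and the CONJUGATED relative bound `hPc : ∀ k y, ‖conjMat P_k·conjMat ((Δ_a^{(k)}⊗1)⁻¹)‖ ≤ κ′`,
   at ANY coupling `‖t‖κ′ < 1`: `hdec` with `(B, δ) = (γw⁻¹(1 − ‖t‖κ′)⁻¹e^{2κ}, κ)`; **`hdec_pertCovC_zero_of_wCoercive`** (`t = 0`, from `hW` alone);
   **`decayStations_pertCovC_of_wCoercive`** (the owner's `decayStations_pertCovC_rate` so fed); and the NON-VACUITY face
   **`entryBound_pertCovC_of_perturbationLaws`**: at `κ = 0` the two inputs ARE `DirichletRegionTower.coercive_calDalev` and tier B's (H-bd), so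
   every family obeying `PerturbationLaws` has King-averaged covariance entries bounded by `(d+1)Cst·(1 − ‖t‖κ₀)⁻¹` UNIFORMLY IN THE LEVEL.

HONEST FRAMING (T4-DAG p. 1).  Torus-block geometry + bookkeeping over landed modules ([folklore]); statements and the data definitions
(`toM`, `distK(C)`, `ctr`, `rhoSite`, `rho`) OURS; the two analytic inputs `hW` (U = 1 Combes–Thomas core — β-cell / substrate VEC, in progress)
and `hPc` (weighted (H-bd) of the perturbation — per summand, later) are DISPLAYED, asserted by nobody; `hdec` with a POSITIVE rate is NOT
discharged here at `U ≠ 1` (at `U = 1`, `t = 0`, `a = 1` it is leaf-05-g5's `FreeTowerEntryDecay` p220045 by another route); sub-row Δ3 NOT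
closed; nothing of node NE3; NE2 (U1a) NOT PROVED; spine PROVED 0/9 unchanged; NOT infinite volume, NOT a mass gap, NOT the Clay problem, NOT
summit progress.  HONEST DEPENDENCY: continuum YM on T⁴ ⇐ BetaPertH ∧ nine spine estimates (0/9 proved); BetaPertH ⇐ (D1) ∧ (D4) ∧ CAP+tail;
G-an2-4 gates asym, D1 and NE2/3/4.  ABSOLUTE RULE kept: no printed statement is a hypothesis; no `def … : Prop` fact; no `sorry`.
-/

noncomputable section

open scoped BigOperators ComplexConjugate Matrix Matrix.Norms.L2Operator Kronecker
open Filter Topology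

namespace Summit.QuantumFields.BalabanUV.T4Continuum.CTKingTowerWeights

open Literature.MathematicalPhysics.QuantumFieldTheory.Balaban1983to89.B5Prop11Plancherel (Cst Tor fine unitVec)
open Literature.MathematicalPhysics.QuantumFieldTheory.Balaban1983to89.B5G183RateUnitTower (lev lev_neZero)
open Literature.MathematicalPhysics.QuantumFieldTheory.Balaban1983to89.B5Block118 (bpt tstep)
open Literature.MathematicalPhysics.QuantumFieldTheory.Balaban1983to89.B5Blocks16 (blockOf blockOf_bpt bpt_val)
open Literature.MathematicalPhysics.QuantumFieldTheory.Balaban1983to89.Beta.VectorTailsCov (tdist tdist_self tdist_triangle tdist_comm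
  tdist_add_unitVec_le supNorm_liftZ_sub_le bpt_add_tstep)
open Summit.QuantumFields.BalabanUV.T4Continuum
open Summit.QuantumFields.BalabanUV.T4Continuum.CovariantAveragingTower (avgTow)
open Summit.QuantumFields.BalabanUV.T4Continuum.BalabanAveragedTowerUnit (idx Qlev one_le_lev' cast_lev' opNorm_Qlev_sq_le)
open Summit.QuantumFields.BalabanUV.T4Continuum.BalabanAveragedTowerModes (par val_par)
open Summit.QuantumFields.BalabanUV.T4Continuum.BackgroundResolventTower
open Summit.QuantumFields.BalabanUV.T4Continuum.KingPairingPlantedLaw (JpcT calDalev CJ)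
open Summit.QuantumFields.BalabanUV.T4Continuum.KroneckerLift (opNorm_kron_le)
open Summit.QuantumFields.BalabanUV.T4Continuum.CTWeightedCoercivity (conjMat WCoercive conjMat_zero)
open Summit.QuantumFields.BalabanUV.T4Continuum.DirichletRegionTower (gamD gamD_pos coercive_calDalev)
open Summit.QuantumFields.BalabanUV.T4Continuum.CTConjugationTorus (bondW₀)
open Summit.QuantumFields.BalabanUV.T4Continuum.CTAveragedTowerDecay
open Summit.QuantumFields.BalabanUV.T4Continuum.BlockSumDecay (prtk prtQ prtQK QlevKron_indicator)
open Summit.QuantumFields.BalabanUV.T4Continuum.DecayRateInterpolation (EntryDecay DecayRate TwoLevelDecayRate)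
open Summit.QuantumFields.BalabanUV.T4Continuum.NE2ColourPerturbedLayer (pertCovC pertLimC)
open Summit.QuantumFields.BalabanUV.T4Continuum.NE2BalabanDecayRate (decayStations_pertCovC_rate)

variable {d : ℕ} (L : ℕ) [NeZero L] (M : Fin d → ℕ) [hM : ∀ μ, NeZero (M μ)]

/-! ## §1 Readings: unit sites in `Tor M`, the iterated parent in coordinates, the unit-lattice distance -/

/-- the unit-lattice site `x ∈ Tor (fine n_0 M)` (`n_0 = 1`) READ IN `Tor M` (same values). [folklore] -/
def toM (x : Tor (fine (lev L 0) M)) : Tor M := fun ν => (((x ν).val : ℕ) : ZMod (M ν))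

/-- values are preserved by the reading (`(x ν).val < 1·M_ν = M_ν`). [folklore] -/
theorem val_toM (x : Tor (fine (lev L 0) M)) (ν : Fin d) : (toM L M x ν).val = (x ν).val := by
  have hx : (x ν).val < M ν := by
    have h := ZMod.val_lt (x ν)
    have e : fine (lev L 0) M ν = M ν := by show 1 * M ν = M ν; exact Nat.one_mul _
    exact lt_of_lt_of_eq h e
  unfold toM
  exact ZMod.val_cast_of_lt hx

/-- **the iterated block parent in coordinates**: `(prtk (prtQ L M) k u).1_ν = ⌊u_ν / n_k⌋`. [folklore] -/
theorem val_prtk : ∀ (k : ℕ) (u : idx L M k) (ν : Fin d), ((prtk (prtQ L M) k u).1 ν).val = (u.1 ν).val / lev L k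
  | 0, u, ν => by simp [prtk, lev]
  | k + 1, u, ν => by
      rw [show prtk (prtQ L M) (k + 1) u = prtk (prtQ L M) k (prtQ L M k u) from rfl, val_prtk k (prtQ L M k u) ν,
        show (prtQ L M k u).1 = par (lev L k) L M u.1 from rfl, val_par, Nat.div_div_eq_div_mul]
      rfl

/-- **pv15's `blockOf` IS the iterated parent read in `Tor M`**: `blockOf n_k M u.1 = toM (prtk (prtQ L M) k u).1`. [folklore] -/
theorem blockOf_eq_toM_prtk (k : ℕ) (u : idx L M k) : blockOf (lev L k) M u.1 = toM L M (prtk (prtQ L M) k u).1 := by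
  set n := lev L k with hn
  have hn0 : 0 < n := Nat.pos_of_ne_zero (NeZero.ne n)
  set y : Tor M := toM L M (prtk (prtQ L M) k u).1 with hy
  set j : Fin d → Fin n := fun ν => ⟨(u.1 ν).val % n, Nat.mod_lt _ hn0⟩ with hj
  have hyv : ∀ ν, (y ν).val = (u.1 ν).val / n := fun ν => by rw [hy, val_toM, val_prtk]
  have e : bpt n M y j = u.1 := by
    funext ν
    apply ZMod.val_injective
    rw [bpt_val, hyv]
    exact Nat.div_add_mod _ _
  rw [← e, blockOf_bpt]

variable (o : Type*) [Fintype o] [DecidableEq o]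

omit [NeZero L] hM [Fintype o] [DecidableEq o] in
/-- the colour rides along the iterated parent: `prtk (prtQK) k u = (prtk (prtQ) k u.1, u.2)`. [folklore] -/
theorem prtk_prtQK : ∀ (k : ℕ) (u : idx L M k × o),
    prtk (ι := fun j => idx L M j × o) (prtQK L M o) k u = (prtk (prtQ L M) k u.1, u.2)
  | 0, _ => rfl
  | k + 1, u => by
      rw [show prtk (ι := fun j => idx L M j × o) (prtQK L M o) (k + 1) u
          = prtk (ι := fun j => idx L M j × o) (prtQK L M o) k (prtQK L M o k u) from rfl, prtk_prtQK k]
      rfl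

/-- **the unit-lattice distance**: the sup-distance of the unit torus `Π_ν ℤ/M_ν` between the sites (components ignored), through
`VectorTailsCov.tdist`. [folklore] -/
def distK (x y : idx L M 0) : ℝ := (tdist (toM L M x.1) (toM L M y.1) : ℝ)

/-- its colour version (colours ignored). [folklore] -/
def distKC (x y : idx L M 0 × o) : ℝ := distK L M x.1 y.1

omit [NeZero L] in
/-- symmetry. [folklore] -/
theorem distK_comm (x y : idx L M 0) : distK L M x y = distK L M y x := by
  unfold distK; rw [tdist_comm]

/-! ## §2 The canonical site weight centred at a unit site: fine-Lipschitz, block oscillation `≤ 1`, `≤ 0` on the centre block, `≥ dist − 2` elsewhere -/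

/-- the CORNER of the block of the unit site `y` at level `k`: the fine point `n_k·y + 0`. [folklore] -/
def ctr (k : ℕ) (y : idx L M 0) : Tor (fine (lev L k) M) := bpt (lev L k) M (toM L M y.1) 0

/-- **THE CANONICAL COMBES–THOMAS SITE WEIGHT** centred at the unit site `y`, at level `k`: `ρ_{k,y}(x) = tdist(ctr_k y, x)/n_k − 1` — the fine
sup-distance to the corner of the block of `y` in UNIT-LATTICE units, shifted so that it is `≤ 0` on that block.  (The substrate cell's
`ScalarCovariantCoercive.rhoS` is the same construction for a fine source SET on `TorusG0Decay.ldist`; this one is centred at a UNIT SITE and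
compared below with the unit-lattice block distance, which is what the averaged-tower dictionary needs.) [folklore] -/
def rhoSite (k : ℕ) (y : idx L M 0) (x : Tor (fine (lev L k) M)) : ℝ := (tdist (ctr L M k y) x : ℝ) / (lev L k) - 1

/-- the weight on the tower index `idx L M k = Tor (fine n_k M) × Fin d`: the site weight of the base site (`CTConjugationTorus.bondW₀`,
the substrate programme VEC's bond-weight convention; `rho k y u = rhoSite k y u.1` by `rfl`). [folklore] -/
abbrev rho (k : ℕ) (y : idx L M 0) : idx L M k → ℝ := bondW₀ (lev L k) M (rhoSite L M k y)

omit hM in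
/-- `rho k y u = rhoSite k y u.1`. [folklore] -/
theorem rho_apply (k : ℕ) (y : idx L M 0) (u : idx L M k) : rho L M k y u = rhoSite L M k y u.1 := rfl

/-- the general oscillation bound: `|ρ x − ρ x′| ≤ tdist(x, x′)/n_k`. [folklore] -/
theorem abs_rhoSite_sub_le (k : ℕ) (y : idx L M 0) (x x' : Tor (fine (lev L k) M)) :
    |rhoSite L M k y x - rhoSite L M k y x'| ≤ (tdist x x' : ℝ) / (lev L k : ℝ) := by
  have hn : (0 : ℝ) < (lev L k : ℝ) := by exact_mod_cast Nat.pos_of_ne_zero (NeZero.ne (lev L k))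
  have h1 : tdist (ctr L M k y) x' ≤ tdist (ctr L M k y) x + tdist x x' := tdist_triangle _ _ _
  have h2 : tdist (ctr L M k y) x ≤ tdist (ctr L M k y) x' + tdist x x' := by
    have h := tdist_triangle (ctr L M k y) x' x
    rwa [tdist_comm x' x] at h
  unfold rhoSite
  rw [show ((tdist (ctr L M k y) x : ℝ)) / (lev L k : ℝ) - 1 - (((tdist (ctr L M k y) x' : ℝ)) / (lev L k : ℝ) - 1)
      = (((tdist (ctr L M k y) x : ℝ)) - (tdist (ctr L M k y) x' : ℝ)) / (lev L k : ℝ) by ring,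
    abs_div, abs_of_pos hn, div_le_div_iff_of_pos_right hn, abs_le]
  constructor
  · have : (tdist (ctr L M k y) x' : ℝ) ≤ (tdist (ctr L M k y) x : ℝ) + (tdist x x' : ℝ) := by exact_mod_cast h1
    linarith
  · have : (tdist (ctr L M k y) x : ℝ) ≤ (tdist (ctr L M k y) x' : ℝ) + (tdist x x' : ℝ) := by exact_mod_cast h2
    linarith

/-- **(G1) THE SITE WEIGHT IS `1/n_k`-LIPSCHITZ ALONG FINE BONDS**: `|ρ(x + e_ν) − ρ(x)| ≤ 1/n_k` (the shape of the substrate's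
`ScalarCovariantCoercive.rhoS_lipschitz`, here without a `2 ≤ n·M_μ` proviso). [folklore] -/
theorem abs_rhoSite_fineStep_le (k : ℕ) (y : idx L M 0) (x : Tor (fine (lev L k) M)) (ν : Fin d) :
    |rhoSite L M k y (x + unitVec (fine (lev L k) M) ν) - rhoSite L M k y x| ≤ 1 / (lev L k : ℝ) := by
  have hn : (0 : ℝ) < (lev L k : ℝ) := by exact_mod_cast Nat.pos_of_ne_zero (NeZero.ne (lev L k))
  refine (abs_rhoSite_sub_le L M k y _ _).trans ?_
  rw [div_le_div_iff_of_pos_right hn, tdist_comm]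
  exact_mod_cast tdist_add_unitVec_le (fine (lev L k) M) x ν

/-- (G1) on the tower index: `|ρ(x + e_ν, μ) − ρ(x, μ)| ≤ 1/n_k` — LITERALLY the `hℓ` binder shape of
`DeltaACombesThomas.ctRowDefect_Lap_le_uniform` / `calG_form_decay_of_pieces`. [folklore] -/
theorem abs_rho_fineStep_le (k : ℕ) (y : idx L M 0) (x : Tor (fine (lev L k) M)) (μ ν : Fin d) :
    |rho L M k y (x + unitVec (fine (lev L k) M) ν, μ) - rho L M k y (x, μ)| ≤ 1 / (lev L k : ℝ) :=
  abs_rhoSite_fineStep_le L M k y x ν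

/-- the fine sup-distance to the corner versus the unit-lattice block distance: `tdist(ctr_k y, u) ≤ n_k·tdist(toM y, block u) + (n_k − 1)`
and `n_k·tdist(toM y, block u) ≤ tdist(ctr_k y, u) + (n_k − 1)`, `block u = toM (prtk u)` (`VectorTailsCov.supNorm_liftZ_sub_le`). [folklore] -/
theorem tdist_ctr_bounds (k : ℕ) (y : idx L M 0) (u : idx L M k) :
    tdist (ctr L M k y) u.1 ≤ lev L k * tdist (toM L M y.1) (toM L M (prtk (prtQ L M) k u).1) + (lev L k - 1) ∧
      lev L k * tdist (toM L M y.1) (toM L M (prtk (prtQ L M) k u).1) ≤ tdist (ctr L M k y) u.1 + (lev L k - 1) := by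
  have h := supNorm_liftZ_sub_le (lev L k) M u.1 (ctr L M k y)
  have hb : blockOf (lev L k) M (ctr L M k y) = toM L M y.1 := blockOf_bpt _ _ _ _
  rw [hb, blockOf_eq_toM_prtk] at h
  exact h

/-- **THE BLOCK OSCILLATION IS `≤ 1`**: two fine sites of one unit block carry weights within `1` of each other (the shape of the substrate's
`ScalarCovariantCoercive.rhoS_osc`). [folklore] -/
theorem abs_rhoSite_sub_le_one_of_blockOf_eq (k : ℕ) (y : idx L M 0) (x x' : Tor (fine (lev L k) M))
    (h : blockOf (lev L k) M x = blockOf (lev L k) M x') : |rhoSite L M k y x - rhoSite L M k y x'| ≤ 1 := by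
  have hn1 : 1 ≤ lev L k := one_le_lev' L k
  have hn : (0 : ℝ) < (lev L k : ℝ) := by exact_mod_cast hn1
  refine (abs_rhoSite_sub_le L M k y x x').trans ?_
  have hb := (supNorm_liftZ_sub_le (lev L k) M x' x).1
  rw [h, tdist_self, mul_zero, zero_add] at hb
  have h' : (tdist x x' : ℝ) ≤ (lev L k : ℝ) - 1 := by
    have := (Nat.cast_le (α := ℝ)).mpr hb
    rw [Nat.cast_sub hn1, Nat.cast_one] at this
    exact this
  rw [div_le_one hn]
  linarith

/-- **(G2a) THE WEIGHT IS NON-POSITIVE ON THE CENTRE BLOCK**: `prtk u = y ⟹ ρ_{k,y}(u) ≤ 0`. [folklore] -/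
theorem rho_nonpos_of_prtk (k : ℕ) (y : idx L M 0) (u : idx L M k) (hu : prtk (prtQ L M) k u = y) : rho L M k y u ≤ 0 := by
  have hn1 : 1 ≤ lev L k := one_le_lev' L k
  have hn : (0 : ℝ) < (lev L k : ℝ) := by exact_mod_cast hn1
  have h := (tdist_ctr_bounds L M k y u).1
  rw [hu, tdist_self, mul_zero, zero_add] at h
  have h' : (tdist (ctr L M k y) u.1 : ℝ) ≤ (lev L k : ℝ) - 1 := by
    have := (Nat.cast_le (α := ℝ)).mpr h
    rw [Nat.cast_sub hn1, Nat.cast_one] at this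
    exact this
  rw [rho_apply]
  unfold rhoSite
  rw [sub_nonpos, div_le_one hn]
  linarith

/-- **(G2b) THE WEIGHT DOMINATES THE BLOCK DISTANCE**: `prtk u = x ⟹ distK x y − 2 ≤ ρ_{k,y}(u)`. [folklore] -/
theorem distK_sub_two_le_rho (k : ℕ) (x y : idx L M 0) (u : idx L M k) (hu : prtk (prtQ L M) k u = x) :
    distK L M x y - 2 ≤ rho L M k y u := by
  have hn1 : 1 ≤ lev L k := one_le_lev' L k
  have hn : (0 : ℝ) < (lev L k : ℝ) := by exact_mod_cast hn1
  have h := (tdist_ctr_bounds L M k y u).2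
  rw [hu] at h
  have h' : (lev L k : ℝ) * (tdist (toM L M y.1) (toM L M x.1) : ℝ) ≤ (tdist (ctr L M k y) u.1 : ℝ) + ((lev L k : ℝ) - 1) := by
    have := (Nat.cast_le (α := ℝ)).mpr h
    rw [Nat.cast_add, Nat.cast_mul, Nat.cast_sub hn1, Nat.cast_one] at this
    exact this
  rw [distK, tdist_comm, rho_apply]
  unfold rhoSite
  rw [le_sub_iff_add_le, le_div_iff₀ hn]
  have hT : 0 ≤ (tdist (toM L M y.1) (toM L M x.1) : ℝ) := Nat.cast_nonneg _
  nlinarith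

/-- two STAPLE POINTS over one unit block (`n_k·z + j + t e_μ`, `0 ≤ t < n_k`: block `z` or its `μ`-neighbour) are within `2n_k − 1` fine
sup-steps (`VectorTailsCov.bpt_add_tstep`, `supNorm_liftZ_sub_le`). [folklore] -/
theorem tdist_stencil_le (k : ℕ) (z : Tor M) (μ : Fin d) (j j' : Fin d → Fin (lev L k)) {t t' : ℕ} (ht : t < lev L k)
    (ht' : t' < lev L k) :
    tdist (bpt (lev L k) M z j + tstep (fine (lev L k) M) μ t) (bpt (lev L k) M z j' + tstep (fine (lev L k) M) μ t')
      ≤ 2 * lev L k - 1 := by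
  have hn1 : 1 ≤ lev L k := one_le_lev' L k
  obtain ⟨z₁, j₁, h₁, hz₁⟩ := bpt_add_tstep (lev L k) M z j μ t ht
  obtain ⟨z₂, j₂, h₂, hz₂⟩ := bpt_add_tstep (lev L k) M z j' μ t' ht'
  rw [h₁, h₂]
  have hb := (supNorm_liftZ_sub_le (lev L k) M (bpt (lev L k) M z₂ j₂) (bpt (lev L k) M z₁ j₁)).1
  rw [blockOf_bpt, blockOf_bpt] at hb
  have hzz : tdist z₁ z₂ ≤ 1 := by
    rcases hz₁ with rfl | rfl <;> rcases hz₂ with rfl | rfl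
    · rw [tdist_self]; exact zero_le_one
    · exact tdist_add_unitVec_le M _ μ
    · rw [tdist_comm]; exact tdist_add_unitVec_le M _ μ
    · rw [tdist_self]; exact zero_le_one
  have hm : lev L k * tdist z₁ z₂ ≤ lev L k * 1 := Nat.mul_le_mul_left _ hzz
  exact hb.trans (by omega)

/-- **THE STENCIL OSCILLATION OF THE WEIGHT IS `≤ 2`**: `|ρ(n_k z + j + t e_μ, μ) − ρ(n_k z + j′ + t′ e_μ, μ)| ≤ 2` — the `hL` binder shape of
`DeltaACombesThomas.ctRowDefect_QvAdj_QvOp_le` / `calG_form_decay_of_pieces` (with its `L := 2`), for every level and centre. [folklore] -/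
theorem abs_rho_stencil_le (k : ℕ) (y : idx L M 0) (z : Tor M) (μ : Fin d) (j j' : Fin d → Fin (lev L k)) {t t' : ℕ}
    (ht : t < lev L k) (ht' : t' < lev L k) :
    |rho L M k y (bpt (lev L k) M z j + tstep (fine (lev L k) M) μ t, μ)
        - rho L M k y (bpt (lev L k) M z j' + tstep (fine (lev L k) M) μ t', μ)| ≤ 2 := by
  have hn1 : 1 ≤ lev L k := one_le_lev' L k
  have hn : (0 : ℝ) < (lev L k : ℝ) := by exact_mod_cast hn1
  rw [rho_apply, rho_apply]
  refine (abs_rhoSite_sub_le L M k y _ _).trans ?_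
  rw [div_le_iff₀ hn]
  have h := tdist_stencil_le L M k z μ j j' ht ht'
  have h' : ((tdist (bpt (lev L k) M z j + tstep (fine (lev L k) M) μ t) (bpt (lev L k) M z j' + tstep (fine (lev L k) M) μ t') : ℕ) : ℝ)
      ≤ 2 * (lev L k : ℝ) - 1 := by
    have := (Nat.cast_le (α := ℝ)).mpr h
    rw [Nat.cast_sub (by omega), Nat.cast_mul, Nat.cast_two, Nat.cast_one] at this
    exact this
  linarith

/-! ## §3 The ENDs on the colour tower: `hdec` from a conjugated-inverse bound, from the two displayed inputs, and the decay stations -/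

section Ends

variable (a : ℝ) (ha : 0 < a)
variable {o}

omit [Fintype o] [DecidableEq o] in
/-- the lifted one-step averagings are small: `‖Q_k ⊗ 1‖² ≤ (L^d)⁻¹`. [folklore] -/
theorem opNorm_QlevKron_sq_le [Fintype o] [DecidableEq o] (k : ℕ) :
    ‖Qlev L M k ⊗ₖ (1 : Matrix o o ℂ)‖ ^ 2 ≤ ((L : ℝ) ^ d)⁻¹ :=
  (pow_le_pow_left₀ (norm_nonneg _) (opNorm_kron_le o (Qlev L M k)) 2).trans (opNorm_Qlev_sq_le L M k)

/-- **`hdec` FROM A LEVEL-UNIFORM CONJUGATED-INVERSE BOUND** at the canonical weights: if for every level `k` and every centre `y`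
`‖conjMat κ ρ_{k,y} ρ_{k,y} ((Δ_a^{(k)}⊗1 + t•P_k)⁻¹)‖ ≤ K` (`κ ≥ 0`), then `∀ k, EntryDecay distKC (pertCovC P t k) (K·e^{2κ}) κ` — the binder
`hdec` of `NE2BalabanDecayRate.decayStations_pertCovC(_rate)` / `balaban_final_decayStations_of_regular`. [folklore] -/
theorem hdec_pertCovC_of_conjInv {P : (k : ℕ) → Matrix (idx L M k × o) (idx L M k × o) ℂ} {t : ℂ} {κ K : ℝ} (hκ : 0 ≤ κ)
    (hK : ∀ (k : ℕ) (y : idx L M 0 × o),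
      ‖conjMat κ (fun p : idx L M k × o => rho L M k y.1 p.1) (fun p : idx L M k × o => rho L M k y.1 p.1)
        (calDalev L M a ha k ⊗ₖ (1 : Matrix o o ℂ) + t • P k)⁻¹‖ ≤ K) (k : ℕ) :
    EntryDecay (distKC L M o) (pertCovC L M a ha P t k) (K * Real.exp (κ * 2)) κ := by
  have hLd : (0 : ℝ) < (L : ℝ) ^ d := pow_pos (by exact_mod_cast Nat.pos_of_ne_zero (NeZero.ne L)) d
  have h := entryDecay_avgTow_of_conjInv (X := fun k => (calDalev L M a ha k ⊗ₖ (1 : Matrix o o ℂ) + t • P k)⁻¹) (k := k)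
    (dist := distKC L M o) (c := 2) (QlevKron_indicator L M o) hLd (opNorm_QlevKron_sq_le L M) hκ
    (fun (y : idx L M 0 × o) (p : idx L M k × o) => rho L M k y.1 p.1) (hK k) ?_ ?_
  · exact h
  · intro y u hu
    rw [prtk_prtQK] at hu
    exact rho_nonpos_of_prtk L M k y.1 u.1 (by rw [← hu])
  · intro x y u hu
    rw [prtk_prtQK] at hu
    have hx : prtk (prtQ L M) k u.1 = x.1 := by rw [← hu]
    exact distK_sub_two_le_rho L M k x.1 y.1 u.1 hx

/-- **`hdec` FROM THE TWO DISPLAYED INPUTS** — the `U = 1` weighted coercivity `hW` of `Δ_a^{(k)}` at the canonical weights (un-lifted; the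
Combes–Thomas core, asserted by nobody here) and the conjugated relative bound `hPc` of the perturbation (the weighted (H-bd); asserted by
nobody here) — at ANY coupling `‖t‖κ′ < 1`: `∀ k, EntryDecay distKC (pertCovC P t k) (γw⁻¹(1 − ‖t‖κ′)⁻¹e^{2κ}) κ`. [folklore] -/
theorem hdec_pertCovC_of_wCoercive {P : (k : ℕ) → Matrix (idx L M k × o) (idx L M k × o) ℂ} {κ γw κ' : ℝ} (hκ : 0 ≤ κ) (hγ : 0 < γw)
    (hW : ∀ (k : ℕ) (y : idx L M 0), WCoercive (calDalev L M a ha k) κ (rho L M k y) γw)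
    (hPc : ∀ (k : ℕ) (y : idx L M 0 × o),
      ‖conjMat κ (fun p : idx L M k × o => rho L M k y.1 p.1) (fun p : idx L M k × o => rho L M k y.1 p.1) (P k)
        * conjMat κ (fun p : idx L M k × o => rho L M k y.1 p.1) (fun p : idx L M k × o => rho L M k y.1 p.1)
          (calDalev L M a ha k ⊗ₖ (1 : Matrix o o ℂ))⁻¹‖ ≤ κ')
    {t : ℂ} (ht : ‖t‖ * κ' < 1) (k : ℕ) :
    EntryDecay (distKC L M o) (pertCovC L M a ha P t k) (γw⁻¹ * (1 - ‖t‖ * κ')⁻¹ * Real.exp (κ * 2)) κ :=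
  hdec_pertCovC_of_conjInv L M a ha hκ (fun k y => opNorm_conjMat_kron_pertInv_le_of_wCoercive (hW k y.1) hγ (hPc k y) ht) k

/-- **THE `t = 0` FACE**: the `U = 1` weighted coercivity ALONE gives `hdec` for the free colour tower `pertCovC P 0` with `(γw⁻¹e^{2κ}, κ)`.
[folklore] -/
theorem hdec_pertCovC_zero_of_wCoercive (P : (k : ℕ) → Matrix (idx L M k × o) (idx L M k × o) ℂ) {κ γw : ℝ} (hκ : 0 ≤ κ)
    (hγ : 0 < γw) (hW : ∀ (k : ℕ) (y : idx L M 0), WCoercive (calDalev L M a ha k) κ (rho L M k y) γw) (k : ℕ) :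
    EntryDecay (distKC L M o) (pertCovC L M a ha P 0 k) (γw⁻¹ * Real.exp (κ * 2)) κ := by
  refine hdec_pertCovC_of_conjInv L M a ha hκ (fun k y => ?_) k
  rw [zero_smul, add_zero]
  exact opNorm_conjMat_kron_inv_le_of_wCoercive (hW k y.1) hγ

/-- **THE DECAY STATIONS FROM THE TWO DISPLAYED INPUTS** (row B8's general rate `L⁻¹ ≤ ρ < 1`): the owner's
`NE2BalabanDecayRate.decayStations_pertCovC_rate` with its binder `hdec` FED by `hdec_pertCovC_of_wCoercive` — limit, limit entry decay
`(B, κ)`, King's (4.38) shapes `(√(2B·Cpert(t)/(1−ρ)), κ/2, √ρ)` / `(√(2B·2Cpert(t)/(1−ρ)), κ/2, √ρ)`, `B = γw⁻¹(1 − ‖t‖κ′)⁻¹e^{2κ}`.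
[cite: King1986, Lemma 4.5 (4.38) p.674 (shape)] [folklore] -/
theorem decayStations_pertCovC_of_wCoercive {ρ : ℝ} (hρ : ((L : ℝ)⁻¹) ≤ ρ) (hρ1 : ρ < 1)
    {P : (k : ℕ) → Matrix (idx L M k × o) (idx L M k × o) ℂ} {κ₀ C₂ : ℝ}
    (hpert : PerturbationLaws (fun k => calDalev L M a ha k ⊗ₖ (1 : Matrix o o ℂ)) P (fun k => JpcT L M k ⊗ₖ (1 : Matrix o o ℂ)) κ₀
      (fun k => C₂ * ρ ^ k)) {t : ℂ} (ht₀ : ‖t‖ * κ₀ < 1)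
    {κ γw κ' : ℝ} (hκ : 0 ≤ κ) (hγ : 0 < γw) (hW : ∀ (k : ℕ) (y : idx L M 0), WCoercive (calDalev L M a ha k) κ (rho L M k y) γw)
    (hPc : ∀ (k : ℕ) (y : idx L M 0 × o),
      ‖conjMat κ (fun p : idx L M k × o => rho L M k y.1 p.1) (fun p : idx L M k × o => rho L M k y.1 p.1) (P k)
        * conjMat κ (fun p : idx L M k × o => rho L M k y.1 p.1) (fun p : idx L M k × o => rho L M k y.1 p.1)
          (calDalev L M a ha k ⊗ₖ (1 : Matrix o o ℂ))⁻¹‖ ≤ κ')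
    (ht : ‖t‖ * κ' < 1) :
    Tendsto (pertCovC L M a ha P t) atTop (𝓝 (pertLimC L M a ha P t)) ∧
      EntryDecay (distKC L M o) (pertLimC L M a ha P t) (γw⁻¹ * (1 - ‖t‖ * κ')⁻¹ * Real.exp (κ * 2)) κ ∧
      DecayRate (distKC L M o) (pertCovC L M a ha P t) (pertLimC L M a ha P t)
        (Real.sqrt (2 * (γw⁻¹ * (1 - ‖t‖ * κ')⁻¹ * Real.exp (κ * 2)) * (Cpert κ₀ (2 * d * Cst d a) (CJ d a) C₂ 0 t / (1 - ρ))))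
        (κ / 2) (Real.sqrt ρ) ∧
      TwoLevelDecayRate (distKC L M o) (pertCovC L M a ha P t)
        (Real.sqrt (2 * (γw⁻¹ * (1 - ‖t‖ * κ')⁻¹ * Real.exp (κ * 2)) * (2 * Cpert κ₀ (2 * d * Cst d a) (CJ d a) C₂ 0 t / (1 - ρ))))
        (κ / 2) (Real.sqrt ρ) :=
  decayStations_pertCovC_rate L M a ha hρ hρ1 hpert ht₀ (hdec_pertCovC_of_wCoercive L M a ha hκ hγ hW hPc ht)

/-- **NON-VACUITY — THE RATE-ZERO FACE IS UNCONDITIONAL**: at `κ = 0` the two displayed inputs ARE the tree's coercivity of `Δ_a^{(k)}`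
(`DirichletRegionTower.coercive_calDalev`, `γ = ((d+1)Cst)⁻¹`) and tier B's (H-bd) `‖P_k(Δ_a^{(k)}⊗1)⁻¹‖ ≤ κ₀` (`PerturbationLaws`); so for
EVERY perturbation family obeying the laws every tier-A/B row lands and every coupling `‖t‖κ₀ < 1`, the entries of the King-averaged
perturbed covariances are bounded by `(d+1)Cst·(1 − ‖t‖κ₀)⁻¹` UNIFORMLY IN THE LEVEL (`hdec` at decay rate `0`, no displayed binder).
[folklore] -/
theorem entryBound_pertCovC_of_perturbationLaws {P : (k : ℕ) → Matrix (idx L M k × o) (idx L M k × o) ℂ} {κ₀ : ℝ} {e₂ : ℕ → ℝ}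
    (hpert : PerturbationLaws (fun k => calDalev L M a ha k ⊗ₖ (1 : Matrix o o ℂ)) P (fun k => JpcT L M k ⊗ₖ (1 : Matrix o o ℂ)) κ₀ e₂)
    {t : ℂ} (ht : ‖t‖ * κ₀ < 1) (k : ℕ) :
    EntryDecay (distKC L M o) (pertCovC L M a ha P t k) (((d : ℝ) + 1) * Cst d a * (1 - ‖t‖ * κ₀)⁻¹) 0 := by
  have hW : ∀ (k : ℕ) (y : idx L M 0), WCoercive (calDalev L M a ha k) 0 (rho L M k y) (gamD d a) :=
    fun k y => wCoercive_zero_of_coercive (fun v => coercive_calDalev L M a ha k v) _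
  have hPc : ∀ (k : ℕ) (y : idx L M 0 × o),
      ‖conjMat 0 (fun p : idx L M k × o => rho L M k y.1 p.1) (fun p : idx L M k × o => rho L M k y.1 p.1) (P k)
        * conjMat 0 (fun p : idx L M k × o => rho L M k y.1 p.1) (fun p : idx L M k × o => rho L M k y.1 p.1)
          (calDalev L M a ha k ⊗ₖ (1 : Matrix o o ℂ))⁻¹‖ ≤ κ₀ := fun k y => by
    rw [conjMat_zero, conjMat_zero]
    exact hpert.opNorm_P_mul_inv_le k
  have h := hdec_pertCovC_of_wCoercive L M a ha (o := o) le_rfl (gamD_pos a) hW hPc ht k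
  have e : (gamD d a)⁻¹ * (1 - ‖t‖ * κ₀)⁻¹ * Real.exp (0 * 2) = ((d : ℝ) + 1) * Cst d a * (1 - ‖t‖ * κ₀)⁻¹ := by
    rw [gamD, inv_inv, zero_mul, Real.exp_zero, mul_one]
  rw [e] at h
  exact h

end Ends

end Summit.QuantumFields.BalabanUV.T4Continuum.CTKingTowerWeights

end
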